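import Summits.QuantumFields.GaugeBoot.BootstrapChargeConjugation
import Summits.QuantumFields.GaugeBoot.CentreSheetTwist
import HarnessLib

/-!
# Symmetries of the bootstrap on GAUGE-INVARIANT data (gauge-boot, L1 supplement)

HONEST FRAMING (cell `pub-gaugeboot`, page 1 of every file): the venture produces certified bounds
on lattice expectations at stated coupling, gauge group, dimension and torus size; NOT a mass gap,
NOT a continuum limit, NOT a string tension; NOT Yang–Mills-summit-bearing (barriers
`FixedCouplingUltralocality`, `PerturbativeInvisibility`). Structural; it certifies no number.

## Content

`BootstrapSymmetryConsequences`, `BootstrapChargeConjugation`, `CentreSheetTwist` showed that every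
solution of the ALL-POLYNOMIAL bootstrap is invariant under the lattice symmetries, charge
conjugation and the centre twists. The Kazakov–Zheng bootstrap has only GAUGE-INVARIANT data
(`GaugeInvariantBootstrap`: `ψ 1 = 1`, loop positivity `0 ≤ ψ(A(a a))`, gauge-averaged loop equations
`IsSDFunctional (ψ ∘ A)`); its solution is the Wilson expectation on the gauge-invariant polynomials
only. For a symmetry `R` to act on these data, `f ∘ R` must again be gauge invariant:

* `NormalisesGauge R` — `R` intertwines the gauge action up to a change of the gauge function
  (`R (U^γ) = (R U)^{γ'}`); then `IsGaugeInvariant f → IsGaugeInvariant (f ∘ R)`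
  (`IsGaugeInvariant.comp_of_normalisesGauge`); instances: translations
  (`gaugeTransform_comp_translateEquiv`), axis permutations (`gaugeTransform_comp_edgePerm`), the site
  reflection (`negReflect_gaugeTransform`), automorphisms link by link (`autCM_gaugeTransform`), centre
  sheet twists (`sheetTwist_gaugeTransform`);
* ★★★ `gaugeInvariantBootstrap_invariant_suN` — `SU(N)`, ANY real `β`: every solution `ψ` of the
  bootstrap on gauge-invariant data satisfies `ψ (f ∘ R) = ψ f` for every gauge-invariant polynomial `f`
  and every polynomial-stable, gauge-normalising symmetry `R` of the Wilson measure; instances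
  `…_translation/_perm/_reflection/_conj/_sheetTwist_suN`.

References: V. Kazakov, Z. Zheng, arXiv:2203.11360 §3.2, arXiv:2404.16925 §3. Folklore.
-/

noncomputable section

open MeasureTheory Filter Topology NormedSpace
open Literature.MathematicalPhysics.QuantumFieldTheory (LatticeRep Site Edge GaugeConfig gaugeTransform IsGaugeInvariant
  wilsonAction wilsonMeasure edgePerm sitePerm)

namespace Summit.QuantumFields.GaugeBoot

/-! ## Symmetries normalising the gauge action -/

section Normalise

variable {d L : ℕ} {G : Type*} [Group G]

/-- **`R` normalises the gauge action**: for every gauge function `γ` there is `γ'` with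
`R (U^γ) = (R U)^{γ'}` for all `U`. [shape] A parametric definition of a proposition — NOT a fact.
[folklore] -/
def NormalisesGauge (R : GaugeConfig d L G → GaugeConfig d L G) : Prop :=
  ∀ γ : Site d L → G, ∃ γ' : Site d L → G, ∀ U, R (gaugeTransform γ U) = gaugeTransform γ' (R U)

/-- **Gauge-invariant observables stay gauge invariant under a gauge-normalising map.** -/
theorem IsGaugeInvariant.comp_of_normalisesGauge {α : Type*} {f : GaugeConfig d L G → α} (hf : IsGaugeInvariant f)
    {R : GaugeConfig d L G → GaugeConfig d L G} (hR : NormalisesGauge R) : IsGaugeInvariant (f ∘ R) := by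
  intro γ U
  obtain ⟨γ', hγ'⟩ := hR γ
  simp only [Function.comp_apply, hγ', hf γ' (R U)]

/-- Translations normalise the gauge action (`γ' = γ(· + a)`). -/
theorem normalisesGauge_translate (a : Site d L) : NormalisesGauge (d := d) (L := L) (G := G) (fun U => U ∘ translateEquiv a) :=
  fun γ => ⟨γ ∘ Equiv.addRight a, fun U => gaugeTransform_comp_translateEquiv γ U a⟩

/-- Axis permutations normalise the gauge action (`γ' = γ ∘ σ`). -/
theorem normalisesGauge_edgePerm (σ : Equiv.Perm (Fin d)) :
    NormalisesGauge (d := d) (L := L) (G := G) (fun U => U ∘ edgePerm σ) :=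
  fun γ => ⟨γ ∘ sitePerm σ, fun U => gaugeTransform_comp_edgePerm γ U σ⟩

/-- A centre sheet twist commutes with every gauge transformation. -/
theorem sheetTwist_gaugeTransform {m : Fin d} {z : G} (hz : z ∈ Subgroup.center G) (γ : Site d L → G) (U : GaugeConfig d L G) :
    sheetTwist m z (gaugeTransform γ U) = gaugeTransform γ (sheetTwist m z U) := by
  funext e
  simp only [sheetTwist_apply, gaugeTransform]
  rw [← mul_assoc, ← mul_assoc, sheetFactor_comm hz e (γ e.1)]
  simp only [mul_assoc]

/-- Centre sheet twists normalise the gauge action (`γ' = γ`). -/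
theorem normalisesGauge_sheetTwist {m : Fin d} {z : G} (hz : z ∈ Subgroup.center G) :
    NormalisesGauge (d := d) (L := L) (sheetTwist m z) :=
  fun γ => ⟨γ, fun U => sheetTwist_gaugeTransform hz γ U⟩

/-- An automorphism applied link by link intertwines the gauge action (`γ' = c ∘ γ`). -/
theorem aut_gaugeTransform (c : G →* G) (γ : Site d L → G) (U : GaugeConfig d L G) :
    c ∘ gaugeTransform γ U = gaugeTransform (c ∘ γ) (c ∘ U) := by
  funext e
  simp [gaugeTransform]

/-- Automorphisms link by link normalise the gauge action. -/
theorem normalisesGauge_aut (c : G →* G) : NormalisesGauge (d := d) (L := L) (fun U => c ∘ U) :=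
  fun γ => ⟨c ∘ γ, fun U => aut_gaugeTransform c γ U⟩

variable [NeZero d]

/-- Site bookkeeping for the reflection: `θ'(θ'(y + e₀)) + e₀ … `: `(θ'(y + e₀)) + e₀ = θ' y`. -/
theorem negReflect_shift_shift_zero' (y : Site d L) : ((y.shift 0).negReflect).shift 0 = y.negReflect := by
  have h := Literature.MathematicalPhysics.QuantumFieldTheory.WilsonSiteRP.negReflect_shift_negReflect_shift y
  have h2 := congrArg Site.negReflect h
  rwa [Literature.MathematicalPhysics.QuantumFieldTheory.WilsonSiteRP.negReflect_negReflect] at h2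

/-- **The site reflection intertwines the gauge action** (`γ' = γ ∘ θ'`). -/
theorem negReflect_gaugeTransform (γ : Site d L → G) (U : GaugeConfig d L G) :
    (gaugeTransform γ U).negReflect = gaugeTransform (γ ∘ Site.negReflect) U.negReflect := by
  funext e
  obtain ⟨y, j⟩ := e
  by_cases hj : j = 0
  · subst hj
    simp only [GaugeConfig.negReflect, if_true, gaugeTransform, Function.comp_apply, mul_inv_rev, inv_inv,
      negReflect_shift_shift_zero', mul_assoc]
  · simp only [GaugeConfig.negReflect, hj, if_false, gaugeTransform, Function.comp_apply,
      Literature.MathematicalPhysics.QuantumFieldTheory.WilsonSiteRP.negReflect_shift_of_ne y hj]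

/-- The site reflection normalises the gauge action. -/
theorem normalisesGauge_negReflect : NormalisesGauge (d := d) (L := L) (G := G) GaugeConfig.negReflect :=
  fun γ => ⟨γ ∘ Site.negReflect, fun U => negReflect_gaugeTransform γ U⟩

end Normalise

/-! ## `SU(N)`: every solution on gauge-invariant data is symmetric -/

section Unitary

open Literature.MathematicalPhysics.QuantumLattice (fundamentalLatticeRep fundamentalRep continuous_fundamentalRep)

variable {d L : ℕ} [NeZero L] (N : ℕ) (β : ℝ)

/-- ★★★ **`SU(N)`, ANY real `β`: every solution of the bootstrap on gauge-invariant data is invariant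
under every gauge-normalising, polynomial-stable symmetry of the Wilson measure**: `ψ (f ∘ R) = ψ f`
for every gauge-invariant polynomial `f`. [folklore] -/
theorem gaugeInvariantBootstrap_invariant_suN
    {ψ : C(GaugeConfig d L (Matrix.specialUnitaryGroup (Fin N) ℂ), ℝ) →ₗ[ℝ] ℝ} (h1 : ψ 1 = 1)
    (hpos : ∀ a ∈ polyAlgebra (ι := Edge d L) (fundamentalLatticeRep N), 0 ≤ ψ (gaugeAvgL d L _ (a * a)))
    (hψ : IsSDFunctional (fundamentalLatticeRep N) (suExp N) (fun _ => wilsonAction (fundamentalRep (Fin N))) β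
      (ψ ∘ₗ gaugeAvgL d L _))
    (R : C(GaugeConfig d L (Matrix.specialUnitaryGroup (Fin N) ℂ), GaugeConfig d L (Matrix.specialUnitaryGroup (Fin N) ℂ)))
    (hRg : NormalisesGauge (⇑R))
    (hR : ∀ f : C(GaugeConfig d L (Matrix.specialUnitaryGroup (Fin N) ℂ), ℝ),
      ∫ U, f (R U) ∂(wilsonMeasure (fundamentalRep (Fin N)) β) =
        ∫ U, f U ∂(wilsonMeasure (d := d) (L := L) (fundamentalRep (Fin N)) β))
    (hRpoly : ∀ g ∈ polyAlgebra (ι := Edge d L) (fundamentalLatticeRep N),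
      g.comp R ∈ polyAlgebra (ι := Edge d L) (fundamentalLatticeRep N))
    {f : C(GaugeConfig d L (Matrix.specialUnitaryGroup (Fin N) ℂ), ℝ)}
    (hf : f ∈ polyAlgebra (ι := Edge d L) (fundamentalLatticeRep N)) (hfi : IsGaugeInvariant (⇑f)) :
    ψ (f.comp R) = ψ f := by
  rw [eq_wilson_of_gaugeInvariantBootstrap_suN N β h1 hpos hψ (hRpoly f hf) (IsGaugeInvariant.comp_of_normalisesGauge hfi hRg),
    eq_wilson_of_gaugeInvariantBootstrap_suN N β h1 hpos hψ hf hfi]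
  exact hR f

variable {ψ : C(GaugeConfig d L (Matrix.specialUnitaryGroup (Fin N) ℂ), ℝ) →ₗ[ℝ] ℝ}

/-- **Translations** on gauge-invariant data. -/
theorem gaugeInvariantBootstrap_translationInvariant_suN (h1 : ψ 1 = 1)
    (hpos : ∀ a ∈ polyAlgebra (ι := Edge d L) (fundamentalLatticeRep N), 0 ≤ ψ (gaugeAvgL d L _ (a * a)))
    (hψ : IsSDFunctional (fundamentalLatticeRep N) (suExp N) (fun _ => wilsonAction (fundamentalRep (Fin N))) β
      (ψ ∘ₗ gaugeAvgL d L _))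
    (a : Site d L) {f : C(GaugeConfig d L (Matrix.specialUnitaryGroup (Fin N) ℂ), ℝ)}
    (hf : f ∈ polyAlgebra (ι := Edge d L) (fundamentalLatticeRep N)) (hfi : IsGaugeInvariant (⇑f)) :
    ψ (f.comp (relabelCM (translateEquiv a))) = ψ f :=
  gaugeInvariantBootstrap_invariant_suN N β h1 hpos hψ _ (normalisesGauge_translate a)
    (fun g => integral_comp_translateEquiv_eq_wilson (fundamentalRep (Fin N)) β a g)
    (fun _ hg => comp_relabelCM_mem_polyAlgebra _ _ hg) hf hfi

/-- **Axis permutations** on gauge-invariant data. -/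
theorem gaugeInvariantBootstrap_permInvariant_suN (h1 : ψ 1 = 1)
    (hpos : ∀ a ∈ polyAlgebra (ι := Edge d L) (fundamentalLatticeRep N), 0 ≤ ψ (gaugeAvgL d L _ (a * a)))
    (hψ : IsSDFunctional (fundamentalLatticeRep N) (suExp N) (fun _ => wilsonAction (fundamentalRep (Fin N))) β
      (ψ ∘ₗ gaugeAvgL d L _))
    (σ : Equiv.Perm (Fin d)) {f : C(GaugeConfig d L (Matrix.specialUnitaryGroup (Fin N) ℂ), ℝ)}
    (hf : f ∈ polyAlgebra (ι := Edge d L) (fundamentalLatticeRep N)) (hfi : IsGaugeInvariant (⇑f)) :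
    ψ (f.comp (relabelCM (edgePerm σ))) = ψ f :=
  gaugeInvariantBootstrap_invariant_suN N β h1 hpos hψ _ (normalisesGauge_edgePerm σ)
    (fun g => integral_comp_edgePerm_eq_wilson (fundamentalRep (Fin N)) (continuous_fundamentalRep _) β σ g)
    (fun _ hg => comp_relabelCM_mem_polyAlgebra _ _ hg) hf hfi

/-- ★★★ **The reflection** on gauge-invariant data (`d ≥ 1`). -/
theorem gaugeInvariantBootstrap_reflectionInvariant_suN [NeZero d] (h1 : ψ 1 = 1)
    (hpos : ∀ a ∈ polyAlgebra (ι := Edge d L) (fundamentalLatticeRep N), 0 ≤ ψ (gaugeAvgL d L _ (a * a)))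
    (hψ : IsSDFunctional (fundamentalLatticeRep N) (suExp N) (fun _ => wilsonAction (fundamentalRep (Fin N))) β
      (ψ ∘ₗ gaugeAvgL d L _))
    {f : C(GaugeConfig d L (Matrix.specialUnitaryGroup (Fin N) ℂ), ℝ)}
    (hf : f ∈ polyAlgebra (ι := Edge d L) (fundamentalLatticeRep N)) (hfi : IsGaugeInvariant (⇑f)) :
    ψ (f.comp negReflectCM) = ψ f :=
  gaugeInvariantBootstrap_invariant_suN N β h1 hpos hψ _ normalisesGauge_negReflect
    (fun g => integral_comp_negReflectCM_eq_wilson (fundamentalRep (Fin N)) (continuous_fundamentalRep _) β g)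
    (fun _ hg => comp_negReflectCM_mem_polyAlgebra _ hg) hf hfi

/-- ★★★ **Charge conjugation** on gauge-invariant data. -/
theorem gaugeInvariantBootstrap_conjInvariant_suN (h1 : ψ 1 = 1)
    (hpos : ∀ a ∈ polyAlgebra (ι := Edge d L) (fundamentalLatticeRep N), 0 ≤ ψ (gaugeAvgL d L _ (a * a)))
    (hψ : IsSDFunctional (fundamentalLatticeRep N) (suExp N) (fun _ => wilsonAction (fundamentalRep (Fin N))) β
      (ψ ∘ₗ gaugeAvgL d L _))
    {f : C(GaugeConfig d L (Matrix.specialUnitaryGroup (Fin N) ℂ), ℝ)}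
    (hf : f ∈ polyAlgebra (ι := Edge d L) (fundamentalLatticeRep N)) (hfi : IsGaugeInvariant (⇑f)) :
    ψ (f.comp (autCM (ι := Edge d L) (chargeConjSU N) (continuous_chargeConjSU N))) = ψ f :=
  gaugeInvariantBootstrap_invariant_suN N β h1 hpos hψ _ (normalisesGauge_aut (chargeConjSU N))
    (fun g => integral_comp_aut_eq_wilson (chargeConjSU N) (fundamentalRep (Fin N)) (continuous_chargeConjSU N)
      (chargeConjSU_involutive N) (trace_re_chargeConjSU N) β g)
    (fun _ hg => comp_autCM_mem_polyAlgebra (chargeConjSU N) (continuous_chargeConjSU N) _ (hgen_chargeConjSU N) hg) hf hfi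

/-- ★★★ **Centre sheet twists** on gauge-invariant data. -/
theorem gaugeInvariantBootstrap_sheetTwistInvariant_suN (h1 : ψ 1 = 1)
    (hpos : ∀ a ∈ polyAlgebra (ι := Edge d L) (fundamentalLatticeRep N), 0 ≤ ψ (gaugeAvgL d L _ (a * a)))
    (hψ : IsSDFunctional (fundamentalLatticeRep N) (suExp N) (fun _ => wilsonAction (fundamentalRep (Fin N))) β
      (ψ ∘ₗ gaugeAvgL d L _))
    (m : Fin d) {z : Matrix.specialUnitaryGroup (Fin N) ℂ} (hz : z ∈ Subgroup.center (Matrix.specialUnitaryGroup (Fin N) ℂ))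
    {f : C(GaugeConfig d L (Matrix.specialUnitaryGroup (Fin N) ℂ), ℝ)}
    (hf : f ∈ polyAlgebra (ι := Edge d L) (fundamentalLatticeRep N)) (hfi : IsGaugeInvariant (⇑f)) :
    ψ (f.comp (sheetTwistCM m z)) = ψ f :=
  gaugeInvariantBootstrap_invariant_suN N β h1 hpos hψ _ (normalisesGauge_sheetTwist hz)
    (fun g => integral_comp_sheetTwist_eq_wilson (fundamentalRep (Fin N)) hz β g)
    (fun _ hg => comp_sheetTwistCM_mem_polyAlgebra _ m z hg) hf hfi

end Unitary

end Summit.QuantumFields.GaugeBoot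

end
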